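import Summits.ResolutionOfSingularities.ResolutionOfSingularities.Theorems.PurelyInseparableDim4ResConeShadeTwoLocated
import HarnessLib
import HarnessLib.Audit.Tags

/-!
# Purely inseparable four-folds — K2(p), PHASE `d = 2`, PART VII: THE LOCATED RESIDUE — the two-light-letter α-tail on the
# ledger `{p − 3, 1, 1, 0}` (every prime; idea-4 I-4-6 (C3-MOVES))

[OURS · counted 0 · cell `res-dim4-pi` · seat res-dim4-p-7 g3 · K2(p) lane (holder res-dim4-p-12 lineage; desk WORDs #82 (c),
#96 (a)); hand analysis res-dim4-idea-4 (card I-4-6).]  Nothing here proves K2(p), `NoIsolatedTrap p p`, or resolution of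
singularities in dimension ≥ 4 / characteristic `p`.  AI kernel work, weaker than expert review.

On the `c = 3` tail of `…ShadeTwoLocated` (`W = p − 1`, unique free letter with its square in the quadric, chart letters light,
heavy letters untouched):
* §1 `heavy_const` / `heavy_of_heavy_later` — the heavy letters (`r ≥ 2`) and their multiplicities are the same at every time;
* §2 **`not_isSatellite_of_two_heavy`** — with TWO heavy letters the boundary has a single light letter, which is the last
  chart letter; the next step is either in the same chart or a swap moving it: NO SATELLITE STEP — so the tree's free-tail
  theorem `FreeTailProof.noIsolatedFreeTailAt_self` forbids two heavy letters; three light letters would give `p = 4`;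
* §3 **`shadeTwo_located`** — THE LOCATED `d = 2` RESIDUE OF K2(p), every prime: an isolated above-floor shade-`2` chain with
  `x^{r₀} ∣ F₀` over a field of characteristic `p` forces `p ≥ 5` and has a tail on which, for ONE FIXED heavy letter `x`,
  `r(x) = p − 3`, one letter `f_k` is free with `x_{f_k}² ∈ supp g_k`, the two remaining letters are light (`r = 1`), every
  chart letter is light or free and becomes light; translated steps (`…ShadeTwoLocated.exists_translated_beyond`) and
  satellite steps (`exists_satellite_beyond`) recur for ever — idea-4's two-letter α-game (I-4-6 (C3-2L)) is exactly what
  remains of the `d = 2` phase.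
bears_on: LADDER-RESOLUTION:D157-DOOR2 (res-dim4-pi · K2(p) · phase d = 2).  Supports stmt-ResolutionOfSingularities-16155
(helper).
-/

set_option linter.dupNamespace false -- mandated namespace of this single-conjunct summit

noncomputable section

namespace Summit.ResolutionOfSingularities.ResolutionOfSingularities.Theorems.PIDim4

namespace ResCone

open MvPolynomial Finset
open Literature.AlgebraicGeometry.Resolution
open Literature.AlgebraicGeometry.Resolution.CentreBlowup
open Literature.AlgebraicGeometry.Resolution.Hauser2010
open Literature.AlgebraicGeometry.Resolution.HauserPerlega2019

variable {K : Type} [Field K] [DecidableEq K]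

/-! ## §0 Two counting helpers on four letters -/

section Count

/-- A ledger vanishing at `f` and equal to `1` elsewhere has weight `3`. [folklore] -/
theorem degree_eq_three_of_light {m : Fin 4 →₀ ℕ} {f : Fin 4} (hf : m f = 0) (h : ∀ i, i ≠ f → m i = 1) :
    m.degree = 3 := by
  rw [Finsupp.degree_eq_sum, ← Finset.add_sum_erase _ _ (Finset.mem_univ f), hf, zero_add,
    Finset.sum_congr rfl fun i hi => h i (Finset.ne_of_mem_erase hi), Finset.sum_const, smul_eq_mul, mul_one,
    Finset.card_erase_of_mem (Finset.mem_univ f), Finset.card_univ, Fintype.card_fin]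

/-- A ledger vanishing at `f`, equal to `1` off `{x, f}`, has weight `m x + 2`. [folklore] -/
theorem degree_eq_add_two_of_light {m : Fin 4 →₀ ℕ} {x f : Fin 4} (hxf : x ≠ f) (hf : m f = 0)
    (h : ∀ i, i ≠ x → i ≠ f → m i = 1) : m.degree = m x + 2 := by
  have hfx : f ∈ (Finset.univ : Finset (Fin 4)).erase x := Finset.mem_erase.mpr ⟨hxf.symm, Finset.mem_univ f⟩
  rw [Finsupp.degree_eq_sum, ← Finset.add_sum_erase _ _ (Finset.mem_univ x), ← Finset.add_sum_erase _ _ hfx, hf,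
    zero_add, Finset.sum_congr rfl fun i hi => h i (Finset.ne_of_mem_erase (Finset.mem_of_mem_erase hi))
      (Finset.ne_of_mem_erase hi), Finset.sum_const, smul_eq_mul, mul_one, Finset.card_erase_of_mem hfx,
    Finset.card_erase_of_mem (Finset.mem_univ x), Finset.card_univ, Fintype.card_fin]

end Count

section Tail

variable {p : ℕ} [hp : Fact p.Prime] {c : ℕ → State K} {j : ℕ → Fin 4} {b : ℕ → Fin 4 → K}

/-! ## §1 Heavy letters are constant on the `c = 3` tail -/

omit [DecidableEq K] hp in
/-- **Heavy letters persist forward** on the `c = 3` tail. [OURS · K2(p) phase d = 2] [folklore] -/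
theorem heavy_const {k₁ : ℕ}
    (htail : ∀ k, k₁ ≤ k → (∀ i, 2 ≤ (c k).r i → (c (k + 1)).r i = (c k).r i) ∧
      (∀ i, 2 ≤ (c (k + 1)).r i → (c (k + 1)).r i = (c k).r i))
    {i : Fin 4} (hi : 2 ≤ (c k₁).r i) (k : ℕ) (hk : k₁ ≤ k) : (c k).r i = (c k₁).r i := by
  obtain ⟨n, rfl⟩ : ∃ n, k = k₁ + n := ⟨k - k₁, by omega⟩
  induction n with
  | zero => rfl
  | succ n ih =>
    have h := ih (by omega)
    rw [← h] at hi ⊢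
    rw [show k₁ + (n + 1) = k₁ + n + 1 by omega]
    exact (htail (k₁ + n) (by omega)).1 i hi

omit [DecidableEq K] hp in
/-- **Heavy letters come from heavy letters** on the `c = 3` tail. [OURS · K2(p) phase d = 2] [folklore] -/
theorem heavy_of_heavy_later {k₁ : ℕ}
    (htail : ∀ k, k₁ ≤ k → (∀ i, 2 ≤ (c k).r i → (c (k + 1)).r i = (c k).r i) ∧
      (∀ i, 2 ≤ (c (k + 1)).r i → (c (k + 1)).r i = (c k).r i))
    {i : Fin 4} (k : ℕ) (hk : k₁ ≤ k) (hi : 2 ≤ (c k).r i) : (c k₁).r i = (c k).r i := by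
  obtain ⟨n, rfl⟩ : ∃ n, k = k₁ + n := ⟨k - k₁, by omega⟩
  induction n with
  | zero => rfl
  | succ n ih =>
    have h := (htail (k₁ + n) (by omega)).2 i (by rwa [show k₁ + (n + 1) = k₁ + n + 1 by omega] at hi)
    rw [show k₁ + (n + 1) = k₁ + n + 1 by omega, h]
    rw [show k₁ + (n + 1) = k₁ + n + 1 by omega, h] at hi
    exact ih (by omega) hi

/-! ## §2 Two heavy letters forbid satellite steps -/

/-- **TWO HEAVY LETTERS ⇒ NO SATELLITE STEP**: on the `c = 3` tail, if `x ≠ y` are heavy at `k + 1` then the only light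
letter of `c (k+1)` is the chart letter `j k`, and step `k + 1` is either in the same chart or a swap moving `j k` — not a
satellite of step `k`. [OURS · K2(p) phase d = 2] [folklore] -/
theorem not_isSatellite_of_two_heavy (hw : FreeTail.IsWitnessedChain p c j b)
    (hc : ∀ k, IsIsolated p (c k).F ∧ Step0 p (c k) (c (k + 1)) ∧ ordZero (c k).F ≠ p ∧ (c k).shade = 2)
    (hr0 : ∀ e ∈ (c 0).F.support, (c 0).r ≤ e) (k : ℕ) (hrj1 : (c (k + 1)).r (j k) = 1)
    (hW : (c (k + 1)).r.degree + 1 = p) {f : Fin 4} (hf0 : (c (k + 1)).r f = 0) (hpos : ∀ i, i ≠ f → 1 ≤ (c (k + 1)).r i)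
    (hsq : coeff (Finsupp.single f 2) (resForm (c (k + 1))) ≠ 0) {x y : Fin 4} (hxy : x ≠ y)
    (hx : 2 ≤ (c (k + 1)).r x) (hy : 2 ≤ (c (k + 1)).r y) : ¬ FreeTail.IsSatellite j b k := by
  rintro ⟨hjj, hbj⟩
  obtain ⟨-, hrj, -, -, -, f', -, -, -, hcases⟩ := cthree_succ hw hc hr0 (k + 1) hW hf0 hpos hsq
  -- the four letters `x, y, f, j k` are pairwise distinct
  have hxj : x ≠ j k := fun h => by rw [h, hrj1] at hx; omega
  have hyj : y ≠ j k := fun h => by rw [h, hrj1] at hy; omega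
  have hxf : x ≠ f := fun h => by rw [h, hf0] at hx; omega
  have hyf : y ≠ f := fun h => by rw [h, hf0] at hy; omega
  have hjf : j k ≠ f := fun h => by rw [h, hf0] at hrj1; omega
  rcases hcases with ⟨hjf', hbu, hru, huf⟩ | ⟨-, hrj', -, -⟩
  · -- a swap: the moved light letter is `j k`
    have hux : f' ≠ x := fun h => by rw [h] at hru; omega
    have huy : f' ≠ y := fun h => by rw [h] at hru; omega
    have hu : f' = j k :=
      fin4_eq_of_forall_ne hxy hxf hyf ⟨hux, huy, huf⟩ ⟨fun h => hxj h.symm, fun h => hyj h.symm, hjf⟩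
    exact hbu (hu ▸ hbj)
  · -- a light chart other than `j k`: but `j k` is the only light letter
    have h1x : j (k + 1) ≠ x := fun h => by rw [h] at hrj'; omega
    have h1y : j (k + 1) ≠ y := fun h => by rw [h] at hrj'; omega
    have h1f : j (k + 1) ≠ f := fun h => by rw [h, hf0] at hrj'; omega
    exact hjj (fin4_eq_of_forall_ne hxy hxf hyf ⟨h1x, h1y, h1f⟩ ⟨fun h => hxj h.symm, fun h => hyj h.symm, hjf⟩)

/-! ## §3 The located residue -/

/-- **Satellite steps recur** (the tree's free-tail theorem). [OURS] [folklore] -/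
theorem exists_satellite_beyond [CharP K p] (hw : FreeTail.IsWitnessedChain p c j b)
    (hc : ∀ k, IsIsolated p (c k).F ∧ Step0 p (c k) (c (k + 1)) ∧ ordZero (c k).F ≠ p ∧ (c k).shade = 2) (k₀ : ℕ) :
    ∃ k, k₀ ≤ k ∧ FreeTail.IsSatellite j b k :=
  (FreeTail.satelliteRecurrenceAt_iff_noIsolatedFreeTailAt p p).mpr (FreeTailProof.noIsolatedFreeTailAt_self p) K c j b hw
    (fun k => (hc k).1) k₀

/-- **THE LOCATED `d = 2` RESIDUE OF K2(p)** (every prime): an isolated above-floor `Step0 p` chain of constant shade `2` with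
`x^{r₀} ∣ F₀` over a field of characteristic `p` forces `5 ≤ p` and has a tail (from `k₁` on) with ONE FIXED heavy letter
`x`, `r_k(x) = p − 3`, total weight `W_k = p − 1`, one free letter `f_k` (`r = 0`) whose square lies in the quadric
(`coeff_{2e_{f_k}} g_k ≠ 0`), the two remaining letters light (`r = 1`); every chart letter is light or free at `k` and light
at `k + 1`.  With `…ShadeTwoLocated.exists_translated_beyond` and `exists_satellite_beyond`: translated steps and changes of
the light chart recur — this two-light-letter α-tail (idea-4's two-letter game, I-4-6 (C3-2L)) is all that remains of the
`d = 2` phase. [OURS · K2(p) phase d = 2] [folklore] -/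
theorem shadeTwo_located [CharP K p] (hw : FreeTail.IsWitnessedChain p c j b)
    (hc : ∀ k, IsIsolated p (c k).F ∧ Step0 p (c k) (c (k + 1)) ∧ ordZero (c k).F ≠ p ∧ (c k).shade = 2)
    (hr0 : ∀ e ∈ (c 0).F.support, (c 0).r ≤ e) :
    ∃ (k₁ : ℕ) (x : Fin 4), 5 ≤ p ∧ ∀ k, k₁ ≤ k →
      (c k).r.degree + 1 = p ∧ (c k).r x + 3 = p ∧ (c k).r (j k) ≤ 1 ∧ (c (k + 1)).r (j k) = 1 ∧
        ∃ f, f ≠ x ∧ (c k).r f = 0 ∧ coeff (Finsupp.single f 2) (resForm (c k)) ≠ 0 ∧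
          ∀ i, i ≠ x → i ≠ f → (c k).r i = 1 := by
  obtain ⟨k₁, htail⟩ := exists_cthree_tail hw hc hr0
  have hheavy : ∀ k, k₁ ≤ k → (∀ i, 2 ≤ (c k).r i → (c (k + 1)).r i = (c k).r i) ∧
      (∀ i, 2 ≤ (c (k + 1)).r i → (c (k + 1)).r i = (c k).r i) :=
    fun k hk => ⟨(htail k hk).2.2.2.1, (htail k hk).2.2.2.2.1⟩
  -- at most one heavy letter at `k₁`
  have hone : ∀ x y, 2 ≤ (c k₁).r x → 2 ≤ (c k₁).r y → x = y := by
    intro x y hx hy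
    by_contra hxy
    obtain ⟨k, hk, hsat⟩ := exists_satellite_beyond hw hc k₁
    obtain ⟨hW1, -, -, -, -, f, hf0, hpos, hsq⟩ := htail (k + 1) (by omega)
    obtain ⟨-, -, hrj1, -, -, -⟩ := htail k hk
    have hxk : 2 ≤ (c (k + 1)).r x := by rw [heavy_const hheavy hx (k + 1) (by omega)]; exact hx
    have hyk : 2 ≤ (c (k + 1)).r y := by rw [heavy_const hheavy hy (k + 1) (by omega)]; exact hy
    exact not_isSatellite_of_two_heavy hw hc hr0 k hrj1 hW1 hf0 hpos hsq hxy hxk hyk hsat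
  -- the weight count at `k₁`: some heavy letter exists
  obtain ⟨hW, -, -, -, -, f₁, hf₁, hpos₁, -⟩ := htail k₁ le_rfl
  have hp4 : p ≠ 4 := fun h => by have := hp.out; rw [h] at this; exact absurd this (by decide)
  obtain ⟨x, hx⟩ : ∃ x, 2 ≤ (c k₁).r x := by
    by_contra hno
    push Not at hno
    -- all boundary letters light: `p − 1 = 3`
    have hge : ∀ i, i ≠ f₁ → (c k₁).r i = 1 := fun i hi => le_antisymm (by have := hno i; omega) (hpos₁ i hi)
    have h3 := degree_eq_three_of_light hf₁ hge
    exact hp4 (by omega)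
  -- its multiplicity is `p − 3`: the other boundary letters are light
  have hxf₁ : x ≠ f₁ := fun h => by rw [h, hf₁] at hx; omega
  have hlight : ∀ i, i ≠ x → i ≠ f₁ → (c k₁).r i = 1 := by
    intro i hix hif
    have h1 := hpos₁ i hif
    by_contra hne
    exact hix (hone i x (by omega) hx)
  have hrx : (c k₁).r x + 3 = p := by
    have h := degree_eq_add_two_of_light hxf₁ hf₁ hlight
    omega
  refine ⟨k₁, x, by omega, fun k hk => ?_⟩
  obtain ⟨hWk, hrj, hrj1, -, -, f, hf0, hpos, hsq⟩ := htail k hk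
  have hxk : (c k).r x = (c k₁).r x := heavy_const hheavy hx k hk
  have hxf : f ≠ x := fun h => by rw [h, hxk] at hf0; omega
  refine ⟨hWk, by rw [hxk]; exact hrx, hrj, hrj1, f, hxf, hf0, hsq, fun i hix hif => ?_⟩
  have h1 := hpos i hif
  by_contra hne
  have h2 : 2 ≤ (c k).r i := by omega
  have h3 := heavy_of_heavy_later hheavy k hk h2
  exact hix (hone i x (by rw [h3]; exact h2) hx)

end Tail

end ResCone

end Summit.ResolutionOfSingularities.ResolutionOfSingularities.Theorems.PIDim4

end
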